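import Literature.MathematicalPhysics.KineticTheory.HardSphereEulerProofs
import Summits.AtomisticToContinuum.HydrodynamicLimit.Theorems.JaynesSqueezeHardSphereLDAEos
import Mathlib.Order.Monotone.Union
import Mathlib.Topology.Order.MonotoneContinuity
import Mathlib.MeasureTheory.Integral.DominatedConvergence
import HarnessLib

/-!
# Hard-sphere local density approximation, IX: activity inversion (clause (A))

Helper file for the support item `HardSphereLDA` (stmt-AtomisticToContinuum-13459) of route
`JaynesSqueeze`: clause (A) of the item. Under the low-density equation of state (`HsEosLowDensity`:
`f_ex = F` on `[0, η₀)`, `F` analytic, `F 0 = 0`) there is `η_A > 0` such that for `σ > 0`,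
`Λ ≥ 1` with `Λ²σ³ ≤ η_A`, every MEASURABLE activity `a` with `Λ⁻¹ ≤ a ≤ Λ` is EXACTLY
`a = e^c ρ e^{g_σ(ρ)}` for a measurable unit-mass density `ρ ∈ [(2Λ²)⁻¹, 2Λ²]` and a constant `c`
(`activity_inversion`).

Proof: the local chemical potential `h_σ = log + g_σ` is continuous and strictly increasing on the
band `[(4Λ²)⁻¹, 4Λ²]` (file II: `h_σ′ ≥ 1/(2r) > 0`); extended linearly outside the band it becomes an
order isomorphism of `ℝ`, whose (continuous, hence measurable) inverse applied to `log a − c` is the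
candidate density `ρ_c`; for `c` in an explicit interval the arguments stay where the extension IS
`h_σ` (so `h_σ(ρ_c) = log a − c` pointwise, `ρ_c ∈ [(2Λ²)⁻¹, 2Λ²]`), the mass `∫ ρ_c` is continuous in
`c` (dominated convergence) and crosses `1` (`|g_σ| ≤ 1/4` on the band), and the intermediate value
theorem fixes `c`. No definitions. prover-pitem-stmt-AtomisticToContinuum-13459-0.
-/

noncomputable section

namespace Summit.AtomisticToContinuum.HydrodynamicLimit.Theorems.HardSphereLDA

open MeasureTheory Filter Set Topology
open Literature.MathematicalPhysics.KineticTheory Literature.Analysis.FluidPDE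

/-! ### A strictly increasing continuous function on a band, extended linearly, is an order isomorphism -/

/-- **Linear extension of a strictly increasing continuous function off a band.** If `h` is
continuous and strictly increasing on `[lo, hi]` (`lo ≤ hi`), then
`ĥ(s) = h(clamp s) + (s − clamp s)`, `clamp s = max lo (min hi s)`, is continuous, strictly
increasing, surjective, and agrees with `h` on the band. [folklore] -/
theorem exists_extension {h : ℝ → ℝ} {lo hi : ℝ} (hlohi : lo ≤ hi) (hc : ContinuousOn h (Icc lo hi))
    (hm : StrictMonoOn h (Icc lo hi)) :
    ∃ e : ℝ ≃o ℝ, Continuous e ∧ Continuous e.symm ∧ ∀ s ∈ Icc lo hi, e s = h s := by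
  set clamp : ℝ → ℝ := fun s => max lo (min hi s) with hclamp
  have hclamp_mem : ∀ s, clamp s ∈ Icc lo hi := fun s => ⟨le_max_left _ _, max_le hlohi (min_le_left _ _)⟩
  have hclamp_id : ∀ s ∈ Icc lo hi, clamp s = s := fun s hs => by
    rw [hclamp]; dsimp only; rw [min_eq_right hs.2, max_eq_right hs.1]
  have hclamp_mono : Monotone clamp := fun s t hst => by
    rw [hclamp]; exact max_le_max le_rfl (min_le_min le_rfl hst)
  have hclamp_lip : ∀ s t, s ≤ t → clamp t - clamp s ≤ t - s := by
    intro s t hst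
    rw [hclamp]; dsimp only
    rcases le_total hi s with h1 | h1
    · rw [min_eq_left h1, min_eq_left (h1.trans hst)]; linarith
    · rw [min_eq_right h1]
      rcases le_total hi t with h2 | h2
      · rw [min_eq_left h2]
        rcases le_total lo s with h3 | h3
        · rw [max_eq_right h3, max_eq_right hlohi]; linarith
        · rw [max_eq_left h3, max_eq_right hlohi]; linarith
      · rw [min_eq_right h2]
        rcases le_total lo s with h3 | h3
        · rw [max_eq_right h3, max_eq_right (h3.trans hst)]
        · rw [max_eq_left h3]
          rcases le_total lo t with h4 | h4
          · rw [max_eq_right h4]; linarith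
          · rw [max_eq_left h4]; linarith
  set f : ℝ → ℝ := fun s => h (clamp s) + (s - clamp s) with hf
  have hfc : Continuous f := by
    have h1 : Continuous clamp := continuous_const.max (continuous_const.min continuous_id)
    exact (hc.comp_continuous h1 hclamp_mem).add (continuous_id.sub h1)
  have hfm : StrictMono f := by
    intro s t hst
    rw [hf]; dsimp only
    have hcl : clamp s ≤ clamp t := hclamp_mono hst.le
    rcases hcl.lt_or_eq with hlt | heq
    · have := hm (hclamp_mem s) (hclamp_mem t) hlt
      have := hclamp_lip s t hst.le
      linarith
    · rw [heq]; linarith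
  have hfband : ∀ s ∈ Icc lo hi, f s = h s := fun s hs => by
    rw [hf]; dsimp only; rw [hclamp_id s hs]; ring
  -- linear growth at `±∞`
  have htop : Tendsto f atTop atTop := by
    refine tendsto_atTop_atTop.2 fun b => ⟨max hi (b - h hi + hi), fun s hs => ?_⟩
    have hs1 : hi ≤ s := (le_max_left _ _).trans hs
    have hcl : clamp s = hi := by
      rw [hclamp]; dsimp only; rw [min_eq_left hs1, max_eq_right hlohi]
    rw [hf]; dsimp only; rw [hcl]
    linarith [(le_max_right _ _).trans hs]
  have hbot : Tendsto f atBot atBot := by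
    refine tendsto_atBot_atBot.2 fun b => ⟨min lo (b - h lo + lo), fun s hs => ?_⟩
    have hs1 : s ≤ lo := hs.trans (min_le_left _ _)
    have hcl : clamp s = lo := by
      rw [hclamp]; dsimp only; rw [min_eq_right (hs1.trans hlohi), max_eq_left hs1]
    rw [hf]; dsimp only; rw [hcl]
    linarith [hs.trans (min_le_right _ _)]
  have hsurj : Function.Surjective f := hfc.surjective htop hbot
  refine ⟨hfm.orderIsoOfSurjective f hsurj, ?_, ?_, fun s hs => ?_⟩
  · exact hfc
  · exact (hfm.orderIsoOfSurjective f hsurj).symm.continuous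
  · exact hfband s hs

/-! ### Activity inversion -/

/-- **CLAUSE (A): ACTIVITY INVERSION.** Under `HsEosLowDensity` (`f_ex = F` on `[0, η₀)`, `F` analytic,
`F 0 = 0`) there is `η_A > 0` such that for all `σ > 0`, `Λ ≥ 1` with `Λ²σ³ ≤ η_A`, every
measurable activity `Λ⁻¹ ≤ a ≤ Λ` is `a = e^c ρ e^{g_σ(ρ)}` for a measurable unit-mass density
`(2Λ²)⁻¹ ≤ ρ ≤ 2Λ²` and a constant `c`. [folklore] -/
theorem activity_inversion {η₀ : ℝ} {F : ℝ → ℝ} (hη₀ : 0 < η₀) (hFa : AnalyticOnNhd ℝ F (Ioo (-η₀) η₀))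
    (hEq : EqOn hsExcessFreeEnergy F (Ico 0 η₀)) (hF0 : F 0 = 0) :
    ∃ ηA : ℝ, 0 < ηA ∧ ∀ σ : ℝ, 0 < σ → ∀ Λ : ℝ, 1 ≤ Λ → Λ ^ 2 * σ ^ 3 ≤ ηA →
      ∀ a : T3 → ℝ, Measurable a → (∀ x, Λ⁻¹ ≤ a x ∧ a x ≤ Λ) →
      ∃ ρa : T3 → ℝ, Measurable ρa ∧ (∀ x, (2 * Λ ^ 2)⁻¹ ≤ ρa x ∧ ρa x ≤ 2 * Λ ^ 2) ∧
        (∫ x, ρa x) = 1 ∧ ∃ c : ℝ, ∀ x, a x = Real.exp c * ρa x *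
          Real.exp (hsExcessFreeEnergy (ρa x * σ ^ 3) + ρa x * σ ^ 3 * deriv hsExcessFreeEnergy (ρa x * σ ^ 3)) := by
  obtain ⟨ηc, hηc0, hηcη₀, C', -, hcalc⟩ := eos_calculus hη₀ hFa hEq
  obtain ⟨C, hC0, hC⟩ := exists_deriv_bound hη₀ hFa
  -- `|F η| ≤ C η` on `[0, η₀/2]`
  have hFle : ∀ η ∈ Icc 0 (η₀ / 2), |F η| ≤ C * η := by
    intro η hη
    have h := (convex_Icc 0 (η₀ / 2)).norm_image_sub_le_of_norm_hasDerivWithin_le (f := F) (f' := deriv F) (C := C)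
      (fun t ht => (hC t ht).2.2.2.1.hasDerivWithinAt) (fun t ht => by rw [Real.norm_eq_abs]; exact (hC t ht).1)
      (left_mem_Icc.2 (by linarith)) hη
    rwa [hF0, sub_zero, sub_zero, Real.norm_eq_abs, Real.norm_eq_abs, abs_of_nonneg hη.1] at h
  -- the threshold
  set ηA : ℝ := min (min (ηc / 4) (η₀ / 8)) (1 / (32 * C + 1)) with hηA
  have hηA0 : 0 < ηA := lt_min (lt_min (by positivity) (by positivity)) (by positivity)
  have hηAc : ηA ≤ ηc / 4 := (min_le_left _ _).trans (min_le_left _ _)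
  have hηA₀ : ηA ≤ η₀ / 8 := (min_le_left _ _).trans (min_le_right _ _)
  have hηAC : ηA ≤ 1 / (32 * C + 1) := min_le_right _ _
  refine ⟨ηA, hηA0, fun σ hσ Λ hΛ hpack a ham hab => ?_⟩
  have hσ3 : 0 < σ ^ 3 := pow_pos hσ 3
  have hΛ0 : 0 < Λ := one_pos.trans_le hΛ
  have hΛ2 : 1 ≤ Λ ^ 2 := one_le_pow₀ hΛ
  obtain ⟨k, k₁, hk⟩ := hcalc σ hσ
  -- the band `[lo, hi] = [(4Λ²)⁻¹, 4Λ²]`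
  set hi : ℝ := 4 * Λ ^ 2 with hhi
  set lo : ℝ := (4 * Λ ^ 2)⁻¹ with hlo
  have hhi1 : 4 ≤ hi := by rw [hhi]; linarith
  have hlo0 : 0 < lo := by rw [hlo]; positivity
  have hlo1 : lo ≤ 1 / 4 := by rw [hlo, inv_eq_one_div]; exact one_div_le_one_div_of_le (by norm_num) hhi1
  have hlohi : lo ≤ hi := by linarith
  have hband : ∀ s ∈ Icc lo hi, 0 < s ∧ s * σ ^ 3 ≤ ηc ∧ s * σ ^ 3 ∈ Icc 0 (η₀ / 2) ∧ s * σ ^ 3 ≤ 4 * ηA := by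
    intro s hs
    have hs0 : 0 < s := hlo0.trans_le hs.1
    have h4 : s * σ ^ 3 ≤ 4 * ηA := by
      calc s * σ ^ 3 ≤ hi * σ ^ 3 := mul_le_mul_of_nonneg_right hs.2 hσ3.le
        _ = 4 * (Λ ^ 2 * σ ^ 3) := by rw [hhi]; ring
        _ ≤ 4 * ηA := by linarith
    have hc' : s * σ ^ 3 ≤ ηc := h4.trans (by linarith)
    exact ⟨hs0, hc', ⟨(mul_pos hs0 hσ3).le, by linarith⟩, h4⟩
  -- the local chemical potential on the band
  set G : ℝ → ℝ := fun s => hsExcessFreeEnergy (s * σ ^ 3) + s * σ ^ 3 * deriv hsExcessFreeEnergy (s * σ ^ 3) with hG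
  set hg : ℝ → ℝ := fun s => Real.log s + G s with hhg
  have hderiv : ∀ s ∈ Icc lo hi, HasDerivAt hg (k s) s ∧ 0 < k s ∧ |G s| ≤ 1 / 4 := by
    intro s hs
    obtain ⟨hs0, hsc, hsI, hs4⟩ := hband s hs
    obtain ⟨-, hGF, hh, hklo, -, -⟩ := hk s hs0 hsc
    refine ⟨hh, lt_of_lt_of_le (by positivity) hklo, ?_⟩
    have hGs : G s = F (s * σ ^ 3) + s * σ ^ 3 * deriv F (s * σ ^ 3) := hGF
    rw [hGs]
    have h1 := hFle _ hsI
    have h2 := (hC _ hsI).1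
    have h8 : 8 * C * ηA ≤ 1 / 4 := by
      have := hηAC
      rw [le_div_iff₀ (by positivity)] at this
      nlinarith
    calc |F (s * σ ^ 3) + s * σ ^ 3 * deriv F (s * σ ^ 3)| ≤ |F (s * σ ^ 3)| + |s * σ ^ 3 * deriv F (s * σ ^ 3)| := abs_add_le _ _
      _ ≤ C * (s * σ ^ 3) + (s * σ ^ 3) * C := by
          refine add_le_add h1 ?_
          rw [abs_mul, abs_of_nonneg hsI.1]
          exact mul_le_mul_of_nonneg_left h2 hsI.1
      _ = 2 * C * (s * σ ^ 3) := by ring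
      _ ≤ 2 * C * (4 * ηA) := by gcongr
      _ ≤ 1 / 4 := by linarith
  have hgc : ContinuousOn hg (Icc lo hi) := fun s hs => (hderiv s hs).1.continuousAt.continuousWithinAt
  have hgm : StrictMonoOn hg (Icc lo hi) := by
    refine strictMonoOn_of_deriv_pos (convex_Icc lo hi) hgc fun s hs => ?_
    rw [interior_Icc] at hs
    have hs' : s ∈ Icc lo hi := ⟨hs.1.le, hs.2.le⟩
    rw [(hderiv s hs').1.deriv]
    exact (hderiv s hs').2.1
  -- the order isomorphism extending `hg`
  obtain ⟨e, hec, hesc, heband⟩ := exists_extension hlohi hgc hgm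
  -- the candidate densities
  set ρc : ℝ → T3 → ℝ := fun c x => e.symm (Real.log (a x) - c) with hρc
  have hloga : ∀ x, |Real.log (a x)| ≤ Real.log Λ := by
    intro x
    have ha0 : 0 < a x := (inv_pos.2 hΛ0).trans_le (hab x).1
    rw [abs_le]
    constructor
    · rw [← Real.log_inv]; exact Real.log_le_log (inv_pos.2 hΛ0) (hab x).1
    · exact Real.log_le_log ha0 (hab x).2
  have hρcm : ∀ c, Measurable (ρc c) := fun c =>
    hesc.measurable.comp ((Real.measurable_log.comp ham).sub measurable_const)
  -- key: if the argument is in `hg '' band` then `ρ_c` is in the band and `hg(ρ_c) = log a - c`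
  have hinv : ∀ y : ℝ, ∀ s ∈ Icc lo hi, hg s = y → e.symm y = s := by
    intro y s hs hsy
    rw [← hsy, ← heband s hs, OrderIso.symm_apply_apply]
  have hmono_inv : ∀ y₁ y₂ : ℝ, y₁ ≤ y₂ → e.symm y₁ ≤ e.symm y₂ := fun y₁ y₂ h => e.symm.monotone h
  -- reference values
  set s₂ : ℝ := 2 * Λ ^ 2 with hs₂
  set s₂' : ℝ := (2 * Λ ^ 2)⁻¹ with hs₂'
  have hs₂mem : s₂ ∈ Icc lo hi := ⟨by rw [hs₂]; linarith, by rw [hs₂, hhi]; linarith⟩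
  have hs₂'mem : s₂' ∈ Icc lo hi := by
    constructor
    · rw [hs₂', hlo]; exact inv_anti₀ (by positivity) (by linarith)
    · rw [hs₂']; calc (2 * Λ ^ 2)⁻¹ ≤ 1 := inv_le_one_of_one_le₀ (by linarith)
        _ ≤ hi := by linarith
  have h1mem : (1 : ℝ) ∈ Icc lo hi := ⟨by linarith, by linarith⟩
  -- the interval of constants
  set chi : ℝ := -Real.log Λ - hg s₂' with hchi
  set clo : ℝ := Real.log Λ - hg s₂ with hclo
  -- values of `hg` at the reference points
  have hlogΛ2 : Real.log (Λ ^ 2) = 2 * Real.log Λ := by rw [Real.log_pow]; norm_num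
  have hg_s₂ : hg s₂ = Real.log 2 + 2 * Real.log Λ + G s₂ := by
    rw [hhg]; dsimp only; rw [hs₂, Real.log_mul (by norm_num) (by positivity), hlogΛ2]
  have hg_s₂' : hg s₂' = -(Real.log 2 + 2 * Real.log Λ) + G s₂' := by
    rw [hhg]; dsimp only; rw [hs₂', Real.log_inv, Real.log_mul (by norm_num) (by positivity), hlogΛ2]
  have hg_1 : hg 1 = G 1 := by rw [hhg]; dsimp only; rw [Real.log_one, zero_add]
  have hG2 := (hderiv s₂ hs₂mem).2.2
  have hG2' := (hderiv s₂' hs₂'mem).2.2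
  have hG1 := (hderiv 1 h1mem).2.2
  have hlog2 : (1 : ℝ) / 2 < Real.log 2 := by
    have := Real.log_two_gt_d9; linarith
  have hlogΛ0 : 0 ≤ Real.log Λ := Real.log_nonneg hΛ
  have hclohi : clo ≤ chi := by
    rw [hclo, hchi, hg_s₂, hg_s₂']
    have := abs_le.1 hG2; have := abs_le.1 hG2'
    linarith
  -- for `c ∈ [clo, chi]` and every `x`, the argument `log a x - c` lies in `[hg s₂', hg s₂]`
  have harg : ∀ c ∈ Icc clo chi, ∀ x, hg s₂' ≤ Real.log (a x) - c ∧ Real.log (a x) - c ≤ hg s₂ := by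
    intro c hcc x
    have h := abs_le.1 (hloga x)
    have h1 : clo ≤ c := hcc.1
    have h2 : c ≤ chi := hcc.2
    rw [hclo] at h1
    rw [hchi] at h2
    constructor <;> linarith
  have hρc_spec : ∀ c ∈ Icc clo chi, ∀ x, ρc c x ∈ Icc s₂' s₂ ∧ hg (ρc c x) = Real.log (a x) - c := by
    intro c hcc x
    obtain ⟨hlow, hup⟩ := harg c hcc x
    -- the argument is a value of `hg` on `[s₂', s₂]` (intermediate value theorem)
    have hsub : Icc s₂' s₂ ⊆ Icc lo hi := Icc_subset_Icc hs₂'mem.1 hs₂mem.2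
    have hs₂'s₂ : s₂' ≤ s₂ := by
      rw [hs₂', hs₂]
      calc (2 * Λ ^ 2)⁻¹ ≤ 1 := inv_le_one_of_one_le₀ (by linarith)
        _ ≤ 2 * Λ ^ 2 := by linarith
    obtain ⟨s, hs, hsy⟩ := intermediate_value_Icc hs₂'s₂ (hgc.mono hsub) ⟨hlow, hup⟩
    have hval : ρc c x = s := by rw [hρc]; exact hinv _ s (hsub hs) hsy
    rw [hval]
    exact ⟨hs, hsy⟩
  -- the mass is continuous in `c` on `[clo, chi]`
  have hmass_cont : ContinuousOn (fun c => ∫ x, ρc c x) (Icc clo chi) := by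
    refine continuousOn_of_dominated (bound := fun _ => s₂) (fun c _ => (hρcm c).aestronglyMeasurable) ?_
      (integrable_const _) ?_
    · intro c hcc
      refine Eventually.of_forall fun x => ?_
      have h := (hρc_spec c hcc x).1
      rw [Real.norm_eq_abs, abs_of_pos ((by rw [hs₂']; positivity : (0 : ℝ) < s₂').trans_le h.1)]
      exact h.2
    · refine Eventually.of_forall fun x => ?_
      exact (hesc.comp (continuous_const.sub continuous_id)).continuousOn
  -- the mass crosses `1`
  have hmass_hi : (∫ x, ρc chi x) ≤ 1 := by
    have hle : ∀ x, ρc chi x ≤ 1 := by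
      intro x
      have hx := (harg chi ⟨hclohi, le_rfl⟩ x)
      -- `log a x - chi ≤ log Λ - chi = hg s₂'`... compare with `hg 1`
      have h1 : Real.log (a x) - chi ≤ hg 1 := by
        rw [hchi, hg_1, hg_s₂']
        have := (abs_le.1 (hloga x)).2; have := abs_le.1 hG2'; have := abs_le.1 hG1
        linarith
      calc ρc chi x = e.symm (Real.log (a x) - chi) := rfl
        _ ≤ e.symm (hg 1) := hmono_inv _ _ h1
        _ = 1 := hinv _ 1 h1mem rfl
    calc (∫ x, ρc chi x) ≤ ∫ _ : T3, (1 : ℝ) := integral_mono_of_nonneg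
          (Eventually.of_forall fun x => ((by rw [hs₂']; positivity : (0 : ℝ) < s₂').trans_le
            (hρc_spec chi ⟨hclohi, le_rfl⟩ x).1.1).le) (integrable_const _) (Eventually.of_forall hle)
      _ = 1 := by rw [integral_const, smul_eq_mul, probReal_univ, one_mul]
  have hmass_lo : 1 ≤ ∫ x, ρc clo x := by
    have hge : ∀ x, 1 ≤ ρc clo x := by
      intro x
      have h1 : hg 1 ≤ Real.log (a x) - clo := by
        rw [hclo, hg_1, hg_s₂]
        have := (abs_le.1 (hloga x)).1; have := abs_le.1 hG2; have := abs_le.1 hG1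
        linarith
      calc (1 : ℝ) = e.symm (hg 1) := (hinv _ 1 h1mem rfl).symm
        _ ≤ e.symm (Real.log (a x) - clo) := hmono_inv _ _ h1
        _ = ρc clo x := rfl
    have hint : Integrable (ρc clo) := Integrable.of_bound (hρcm clo).aestronglyMeasurable s₂
      (Eventually.of_forall fun x => by
        have h := (hρc_spec clo ⟨le_rfl, hclohi⟩ x).1
        rw [Real.norm_eq_abs, abs_of_pos ((by rw [hs₂']; positivity : (0 : ℝ) < s₂').trans_le h.1)]
        exact h.2)
    calc (1 : ℝ) = ∫ _ : T3, (1 : ℝ) := by rw [integral_const, smul_eq_mul, probReal_univ, one_mul]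
      _ ≤ ∫ x, ρc clo x := integral_mono (integrable_const _) hint hge
  -- intermediate value theorem in `c`
  obtain ⟨c, hcmem, hc1⟩ : ∃ c ∈ Icc clo chi, (∫ x, ρc c x) = 1 := by
    have h := intermediate_value_Icc' hclohi hmass_cont
    exact h ⟨hmass_hi, hmass_lo⟩
  refine ⟨ρc c, hρcm c, fun x => ?_, hc1, c, fun x => ?_⟩
  · have h := (hρc_spec c hcmem x).1
    rw [hs₂', hs₂] at h
    exact h
  · obtain ⟨hmemx, hgx⟩ := hρc_spec c hcmem x
    have hρ0 : 0 < ρc c x := (by rw [hs₂']; positivity : (0 : ℝ) < s₂').trans_le hmemx.1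
    have ha0 : 0 < a x := (inv_pos.2 hΛ0).trans_le (hab x).1
    -- `log ρ + G ρ = log a - c`
    rw [hhg] at hgx; dsimp only at hgx
    have : Real.log (a x) = c + Real.log (ρc c x) + G (ρc c x) := by linarith
    calc a x = Real.exp (Real.log (a x)) := (Real.exp_log ha0).symm
      _ = Real.exp c * ρc c x * Real.exp (G (ρc c x)) := by
          rw [this, Real.exp_add, Real.exp_add, Real.exp_log hρ0]

end Summit.AtomisticToContinuum.HydrodynamicLimit.Theorems.HardSphereLDA

end
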